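import Mathlib.Analysis.SpecialFunctions.PolarCoord
import Literature.Probability.RandomMatrix.TwoQubitSeparabilityVolumesRebitFibreIntegral

/-!
# Lovas–Andai 2017 on the maximally mixed fibre — eigenvalue coordinates and the reduction (part 4)

Towards `LovasAndai2017_rebit_fibre_separability_probability_holds`
(`Literature/Probability/RandomMatrix/TwoQubitSeparabilityVolumes.lean`). This file finishes the
GEOMETRIC part of [LovasAndai2017, proof of Theorem 2 with Corollary 2] on the fibre `D = ½·1₂`:

* `lintegral_radial_fin_two`, `lintegral_eigenCoord` — polar coordinates in the traceless part of
  `X = [[x₀,x₂],[x₂,x₁]]`: for the eigenvalues `a = s̄ + r ≥ b = s̄ − r`,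
  `∫_{ℝ³} Φ(a, b) dx = π ∫∫_{b<a} (a − b) Φ(a, b) da db` (the source's "by the unitary invariance
  we can write `𝒫_sep(ℝ) = ∫∫ χ̃₁(…)(1−x²)(1−y²)(x−y) / ∫∫ (1−x²)(1−y²)(x−y)`");
* `measurable_lovasAndaiChiOne`;
* `rebit_fibre_separability_probability_of_eigenIntegral` — **the fact follows from the identity
  `64 ∫∫_{0<b<a<½} (a−b)ab(½−a)(½−b) χ₁(√(b(½−a)/(a(½−b))))`
  `= 29 ∫∫_{0<b<a<½} (a−b)ab(½−a)(½−b) χ₁(1)`**,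
  i.e. from `E[χ̃₁(ε)] = 29/64` over the ordered eigenvalue pairs — which is exactly what the
  analytic part of the source's proof of Theorem 2 (Lemma 6 and the integration by parts with
  dilogarithms, "`(16/35 − 1/4)/(16/35) = 29/64`") establishes; that identity is the subject of the
  remaining part.

## References

* [LovasAndai2017] A. Lovas, A. Andai, J. Phys. A 50 (2017) 295303, Theorem 2 (proof),
  Corollary 2. arXiv:1610.01410.
-/

noncomputable section

open MeasureTheory Set Matrix Real
open scoped ENNReal Matrix

namespace Literature.Probability.RandomMatrix.LovasAndai

open Literature.Probability.RandomMatrix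

/-- Radial functions on `ℝ²` (coordinates `Fin 2 → ℝ`):
`∫ h(√(v₀²+v₁²)) dv = 2π ∫_{r>0} r h(r) dr`. [folklore] -/
theorem lintegral_radial_fin_two (h : ℝ → ℝ≥0∞) (hh : Measurable h) :
    ∫⁻ v : Fin 2 → ℝ, h (Real.sqrt (v 0 ^ 2 + v 1 ^ 2)) =
      ENNReal.ofReal (2 * π) * ∫⁻ r in Ioi (0 : ℝ), ENNReal.ofReal r * h r := by
  -- to `ℝ × ℝ`
  have e := volume_preserving_finTwoArrow ℝ
  have h1 : ∫⁻ v : Fin 2 → ℝ, h (Real.sqrt (v 0 ^ 2 + v 1 ^ 2)) =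
      ∫⁻ p : ℝ × ℝ, h (Real.sqrt (p.1 ^ 2 + p.2 ^ 2)) := by
    rw [← e.lintegral_comp
      (by fun_prop : Measurable fun p : ℝ × ℝ => h (Real.sqrt (p.1 ^ 2 + p.2 ^ 2)))]
    rfl
  rw [h1, ← lintegral_comp_polarCoord_symm]
  have h2 : ∀ q ∈ polarCoord.target, ENNReal.ofReal q.1 • h (Real.sqrt ((polarCoord.symm q).1 ^ 2 +
      (polarCoord.symm q).2 ^ 2)) = ENNReal.ofReal q.1 * h q.1 := by
    rintro ⟨r, θ⟩ ⟨hr, -⟩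
    simp only [polarCoord_symm_apply, smul_eq_mul]
    congr 2
    have : (r * Real.cos θ) ^ 2 + (r * Real.sin θ) ^ 2 = r ^ 2 := by
      have := Real.cos_sq_add_sin_sq θ
      nlinarith [this]
    rw [this, Real.sqrt_sq (le_of_lt hr)]
  rw [setLIntegral_congr_fun polarCoord.open_target.measurableSet h2]
  rw [show polarCoord.target = Ioi (0 : ℝ) ×ˢ Ioo (-π) π from rfl, Measure.volume_eq_prod,
    ← Measure.prod_restrict]
  rw [lintegral_prod _
    (by fun_prop : Measurable fun q : ℝ × ℝ => ENNReal.ofReal q.1 * h q.1).aemeasurable]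
  simp only [lintegral_const, Measure.restrict_apply MeasurableSet.univ, univ_inter,
    Real.volume_Ioo]
  rw [lintegral_mul_const _ (by fun_prop), mul_comm]
  congr 1
  congr 1
  ring

/-- **Eigenvalue coordinates on `Sym₂(ℝ) ≅ ℝ³`.** For `X = [[x₀, x₂], [x₂, x₁]]` with eigenvalues
`s̄ ± r`, `s̄ = (x₀+x₁)/2`, `r = √(((x₀−x₁)/2)² + x₂²)`, and every measurable `Φ ≥ 0`:
`∫_{ℝ³} Φ(s̄+r, s̄−r) dx = π ∫∫_{b<a} (a − b) Φ(a, b) da db`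
(the linear change `(x₀,x₁,x₂) ↦ (s̄, (x₀−x₁)/2, x₂)` of Jacobian `½`, polar coordinates in the
last two variables, and `(s̄, r) ↦ (a, b) = (s̄+r, s̄−r)` of Jacobian `2`; this is the `2 × 2`
case of
the Weyl integration formula used in [LovasAndai2017, proof of Theorem 2]: "Using the fact that
`μ_{d+2}` and `σ(…)` are invariant under orthogonal transformation, we can simplify …").
[cite: LovasAndai2017, proof of Theorem 2 (first display)] -/
theorem lintegral_eigenCoord (Φ : ℝ → ℝ → ℝ≥0∞) (hΦ : Measurable (Function.uncurry Φ)) :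
    ∫⁻ x : Fin 3 → ℝ, Φ ((x 0 + x 1) / 2 + Real.sqrt (((x 0 - x 1) / 2) ^ 2 + x 2 ^ 2))
        ((x 0 + x 1) / 2 - Real.sqrt (((x 0 - x 1) / 2) ^ 2 + x 2 ^ 2)) =
      ENNReal.ofReal π * ∫⁻ p : ℝ × ℝ,
        {p : ℝ × ℝ | p.2 < p.1}.indicator (fun p => ENNReal.ofReal (p.1 - p.2) * Φ p.1 p.2) p := by
  have hΦ2 : ∀ {α : Type} [MeasurableSpace α] {f g : α → ℝ}, Measurable f → Measurable g →
      Measurable fun a => Φ (f a) (g a) := fun hf hg => hΦ.comp (hf.prodMk hg)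
  -- Step 1: the linear change `(x₀,x₁,x₂) ↦ (s̄, (x₀−x₁)/2, x₂)`
  set T₁ : (Fin 3 → ℝ) →ₗ[ℝ] (Fin 3 → ℝ) :=
    Matrix.toLin' !![(1 / 2 : ℝ), 1 / 2, 0; 1 / 2, -1 / 2, 0; 0, 0, 1] with hT₁
  have hT₁apply : ∀ x : Fin 3 → ℝ, T₁ x = ![(x 0 + x 1) / 2, (x 0 - x 1) / 2, x 2] := by
    intro x
    rw [hT₁, Matrix.toLin'_apply]
    ext i
    fin_cases i <;> simp [Matrix.mulVec, dotProduct, Fin.sum_univ_three] <;> ring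
  have hT₁det : LinearMap.det T₁ = -1 / 2 := by
    rw [hT₁, LinearMap.det_toLin', Matrix.det_fin_three]
    simp
    norm_num
  set G : (Fin 3 → ℝ) → ℝ≥0∞ := fun y =>
    Φ (y 0 + Real.sqrt (y 1 ^ 2 + y 2 ^ 2)) (y 0 - Real.sqrt (y 1 ^ 2 + y 2 ^ 2)) with hG
  have hGmeas : Measurable G := hΦ2 (by fun_prop) (by fun_prop)
  have step1 : ∫⁻ x : Fin 3 → ℝ, Φ ((x 0 + x 1) / 2 + Real.sqrt (((x 0 - x 1) / 2) ^ 2 + x 2 ^ 2))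
      ((x 0 + x 1) / 2 - Real.sqrt (((x 0 - x 1) / 2) ^ 2 + x 2 ^ 2)) = 2 * ∫⁻ y, G y := by
    have hcomp : (fun x : Fin 3 → ℝ =>
        Φ ((x 0 + x 1) / 2 + Real.sqrt (((x 0 - x 1) / 2) ^ 2 + x 2 ^ 2))
        ((x 0 + x 1) / 2 - Real.sqrt (((x 0 - x 1) / 2) ^ 2 + x 2 ^ 2))) = G ∘ T₁ := by
      funext x
      simp only [Function.comp_apply, hT₁apply, hG, Matrix.cons_val_zero, Matrix.cons_val_one,
        Matrix.cons_val]
    have hmeasT : Measurable (⇑T₁) := (LinearMap.continuous_of_finiteDimensional T₁).measurable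
    rw [hcomp]
    change ∫⁻ x, G (T₁ x) = _
    have hdet0 : LinearMap.det T₁ ≠ 0 := by rw [hT₁det]; norm_num
    rw [← lintegral_map hGmeas hmeasT,
      Measure.map_linearMap_addHaar_eq_smul_addHaar volume hdet0,
      lintegral_smul_measure, hT₁det]
    norm_num
  rw [step1]
  -- Step 2: split `ℝ³ = ℝ × ℝ²` and integrate the radial variable
  have step2 : ∫⁻ y, G y = ∫⁻ s : ℝ, ∫⁻ v : Fin 2 → ℝ,
      Φ (s + Real.sqrt (v 0 ^ 2 + v 1 ^ 2)) (s - Real.sqrt (v 0 ^ 2 + v 1 ^ 2)) := by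
    have e := volume_preserving_piFinSuccAbove (fun _ : Fin 3 => ℝ) 0
    have hH : Measurable fun p : ℝ × (Fin 2 → ℝ) =>
        Φ (p.1 + Real.sqrt (p.2 0 ^ 2 + p.2 1 ^ 2)) (p.1 - Real.sqrt (p.2 0 ^ 2 + p.2 1 ^ 2)) :=
      hΦ2 (by fun_prop) (by fun_prop)
    rw [← lintegral_prod _ hH.aemeasurable, ← Measure.volume_eq_prod,
      ← e.lintegral_comp_emb (MeasurableEquiv.measurableEmbedding _)]
    rfl
  rw [step2]
  have step3 : ∀ s : ℝ, ∫⁻ v : Fin 2 → ℝ,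
      Φ (s + Real.sqrt (v 0 ^ 2 + v 1 ^ 2)) (s - Real.sqrt (v 0 ^ 2 + v 1 ^ 2)) =
      ENNReal.ofReal (2 * π) * ∫⁻ r in Ioi (0 : ℝ), ENNReal.ofReal r * Φ (s + r) (s - r) :=
    fun s => lintegral_radial_fin_two (fun r => Φ (s + r) (s - r)) (hΦ2 (by fun_prop) (by fun_prop))
  simp_rw [step3]
  have hFmeas : Measurable fun p : ℝ × ℝ => ENNReal.ofReal p.2 * Φ (p.1 + p.2) (p.1 - p.2) :=
    (by fun_prop : Measurable fun p : ℝ × ℝ => ENNReal.ofReal p.2).mul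
      (hΦ2 (by fun_prop) (by fun_prop))
  rw [lintegral_const_mul _ hFmeas.lintegral_prod_right']
  -- Step 4a: back to a double integral over `ℝ × ℝ`
  have h4 : ∫⁻ s : ℝ, ∫⁻ r in Ioi (0 : ℝ), ENNReal.ofReal r * Φ (s + r) (s - r) =
      ∫⁻ p : ℝ × ℝ, {p : ℝ × ℝ | 0 < p.2}.indicator
        (fun p => ENNReal.ofReal p.2 * Φ (p.1 + p.2) (p.1 - p.2)) p := by
    rw [Measure.volume_eq_prod, lintegral_prod _
      ((hFmeas.indicator (measurableSet_lt measurable_const measurable_snd)).aemeasurable)]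
    refine lintegral_congr fun s => ?_
    rw [← lintegral_indicator measurableSet_Ioi]
    rfl
  rw [h4]
  -- Step 4b: the linear change `(s, r) ↦ (s + r, s − r)`
  set T₂ : ℝ × ℝ →ₗ[ℝ] ℝ × ℝ :=
    Matrix.toLin (Module.Basis.finTwoProd ℝ) (Module.Basis.finTwoProd ℝ) !![(1 : ℝ), 1; 1, -1]
    with hT₂
  have hT₂apply : ∀ p : ℝ × ℝ, T₂ p = (p.1 + p.2, p.1 - p.2) := by
    intro p
    rw [hT₂, Matrix.toLin_finTwoProd_apply]
    simp
    ring
  have hT₂det : LinearMap.det T₂ = -2 := by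
    rw [hT₂, LinearMap.det_toLin, Matrix.det_fin_two_of]; norm_num
  set K : ℝ × ℝ → ℝ≥0∞ := fun q => {q : ℝ × ℝ | q.2 < q.1}.indicator
    (fun q => ENNReal.ofReal ((q.1 - q.2) / 2) * Φ q.1 q.2) q with hK
  have hKmeas : Measurable K :=
    ((by fun_prop : Measurable fun q : ℝ × ℝ => ENNReal.ofReal ((q.1 - q.2) / 2)).mul
      (hΦ2 measurable_fst measurable_snd)).indicator
      (measurableSet_lt measurable_snd measurable_fst)
  have hcomp2 : (fun p : ℝ × ℝ => {p : ℝ × ℝ | 0 < p.2}.indicator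
      (fun p => ENNReal.ofReal p.2 * Φ (p.1 + p.2) (p.1 - p.2)) p) = fun p => K (T₂ p) := by
    funext p
    rw [hT₂apply]
    simp only [hK, indicator, mem_setOf_eq]
    by_cases hp : 0 < p.2
    · rw [if_pos hp, if_pos (by linarith)]
      congr 2
      ring
    · rw [if_neg hp, if_neg (by linarith)]
  have hmeasT2 : Measurable (⇑T₂) := (LinearMap.continuous_of_finiteDimensional T₂).measurable
  have hdet2 : LinearMap.det T₂ ≠ 0 := by rw [hT₂det]; norm_num
  rw [hcomp2, ← lintegral_map hKmeas hmeasT2,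
    Measure.map_linearMap_addHaar_eq_smul_addHaar volume hdet2, lintegral_smul_measure, hT₂det,
    smul_eq_mul]
  -- Step 4c: constants
  have hK2 : ∀ q : ℝ × ℝ, K q = ENNReal.ofReal (1 / 2) * {q : ℝ × ℝ | q.2 < q.1}.indicator
      (fun q => ENNReal.ofReal (q.1 - q.2) * Φ q.1 q.2) q := by
    intro q
    simp only [hK, indicator, mem_setOf_eq]
    by_cases hq : q.2 < q.1
    · rw [if_pos hq, if_pos hq, ← mul_assoc, ← ENNReal.ofReal_mul (by norm_num)]
      congr 2
      ring
    · rw [if_neg hq, if_neg hq, mul_zero]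
  simp_rw [hK2]
  have hmul' : Measurable fun q : ℝ × ℝ => ENNReal.ofReal (q.1 - q.2) * Φ q.1 q.2 :=
    Measurable.mul (by fun_prop) (hΦ2 measurable_fst measurable_snd)
  rw [lintegral_const_mul _ (hmul'.indicator (measurableSet_lt measurable_snd measurable_fst))]
  have hc : (2 : ℝ≥0∞) * (ENNReal.ofReal (2 * π) * (ENNReal.ofReal |(-2 : ℝ)⁻¹| *
      ENNReal.ofReal (1 / 2))) = ENNReal.ofReal π := by
    rw [show (2 : ℝ≥0∞) = ENNReal.ofReal 2 by simp, show |(-2 : ℝ)⁻¹| = 1 / 2 by norm_num,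
      ← ENNReal.ofReal_mul (by norm_num), ← ENNReal.ofReal_mul (by positivity),
      ← ENNReal.ofReal_mul (by positivity)]
    congr 1
    ring
  rw [← hc]
  ring


/-! ### Measurability of `χ₁` and the assembly -/

/-- `ε ↦ χ₁(ε)` is measurable (the volume of the `ε`-section of a measurable subset of `ℝ × ℝ⁴`).
[folklore] -/
theorem measurable_lovasAndaiChiOne : Measurable lovasAndaiChiOne := by
  have hfun : lovasAndaiChiOne = fun ε => volume (Prod.mk ε ⁻¹'
      {q : ℝ × (Fin 4 → ℝ) | LovasAndaiLemma6.twiceOpNorm (q.2 0) (q.2 1) (q.2 2) (q.2 3) < 2 ∧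
        LovasAndaiLemma6.twiceOpNorm (q.2 0) (q.1 * q.2 1) (q.2 2 / q.1) (q.2 3) < 2}) := by
    funext ε
    rw [LovasAndaiLemma6.lovasAndaiChiOne_eq_volume_normSet]
    rfl
  rw [hfun]
  refine measurable_measure_prodMk_left ?_
  have h0 : Measurable fun q : ℝ × (Fin 4 → ℝ) => q.2 0 :=
    (measurable_pi_apply 0).comp measurable_snd
  have h1 : Measurable fun q : ℝ × (Fin 4 → ℝ) => q.2 1 :=
    (measurable_pi_apply 1).comp measurable_snd
  have h2 : Measurable fun q : ℝ × (Fin 4 → ℝ) => q.2 2 :=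
    (measurable_pi_apply 2).comp measurable_snd
  have h3 : Measurable fun q : ℝ × (Fin 4 → ℝ) => q.2 3 :=
    (measurable_pi_apply 3).comp measurable_snd
  have hc2 : Measurable fun _ : ℝ × (Fin 4 → ℝ) => (2 : ℝ) := measurable_const
  exact (measurableSet_lt (LovasAndaiLemma6.measurable_twiceOpNorm_comp h0 h1 h2 h3) hc2).inter
    (measurableSet_lt (LovasAndaiLemma6.measurable_twiceOpNorm_comp h0 (measurable_fst.mul h1)
      (h2.div measurable_fst) h3) hc2)

/-- **Reduction of the fibre fact to an identity between two integrals over the ordered eigenvalue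
pairs `0 < b < a < ½`** (the form in which [LovasAndai2017] prove Theorem 2: `𝒫_sep(ℝ)` as the
quotient of `∫∫ χ̃₁(…)(1−x²)(1−y²)(x−y)` by `∫∫ (1−x²)(1−y²)(x−y)`, first display of the proof of
Theorem 2, here on `(a, b) = ((1+x)/4, (1+y)/4)`): if
`64 ∫∫_{0<b<a<½} (a−b)ab(½−a)(½−b) χ₁(√(b(½−a)/(a(½−b)))) = 29 ∫∫_{0<b<a<½} (a−b)ab(½−a)(½−b) χ₁(1)`
then `LovasAndai2017_rebit_fibre_separability_probability`.
[cite: LovasAndai2017, proof of Theorem 2] -/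
theorem rebit_fibre_separability_probability_of_eigenIntegral
    (h : 64 * ∫⁻ p : ℝ × ℝ, {p : ℝ × ℝ | 0 < p.2 ∧ p.2 < p.1 ∧ p.1 < 1 / 2}.indicator
        (fun p => ENNReal.ofReal ((p.1 - p.2) * (p.1 * p.2 * ((1 / 2 - p.1) * (1 / 2 - p.2)))) *
          lovasAndaiChiOne (Real.sqrt (p.2 * (1 / 2 - p.1) / (p.1 * (1 / 2 - p.2))))) p =
      29 * ∫⁻ p : ℝ × ℝ, {p : ℝ × ℝ | 0 < p.2 ∧ p.2 < p.1 ∧ p.1 < 1 / 2}.indicator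
        (fun p => ENNReal.ofReal ((p.1 - p.2) * (p.1 * p.2 * ((1 / 2 - p.1) * (1 / 2 - p.2)))) *
          lovasAndaiChiOne 1) p) :
    LovasAndai2017_rebit_fibre_separability_probability := by
  rw [LovasAndai2017_rebit_fibre_separability_probability_iff_spectral,
    volume_posDef_and_rebitFibre_eq_lintegral, volume_posDef_rebitFibre_eq_lintegral]
  -- the two integrands as functions of the eigenvalues `s̄ ± r`
  set Φ₁ : ℝ → ℝ → ℝ≥0∞ := fun a b => if 0 < b ∧ a < 1 / 2 then
    ENNReal.ofReal (a * b * ((1 / 2 - a) * (1 / 2 - b))) * lovasAndaiChiOne 1 else 0 with hΦ₁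
  set Φ₂ : ℝ → ℝ → ℝ≥0∞ := fun a b => if 0 < b ∧ a < 1 / 2 then
    ENNReal.ofReal (a * b * ((1 / 2 - a) * (1 / 2 - b))) *
      lovasAndaiChiOne (Real.sqrt (b * (1 / 2 - a) / (a * (1 / 2 - b)))) else 0 with hΦ₂
  have hdet : ∀ x' : Fin 3 → ℝ,
      (x' 0 * x' 1 - x' 2 ^ 2) * ((1 / 2 - x' 0) * (1 / 2 - x' 1) - x' 2 ^ 2) =
      ((x' 0 + x' 1) / 2 + Real.sqrt (((x' 0 - x' 1) / 2) ^ 2 + x' 2 ^ 2)) *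
        ((x' 0 + x' 1) / 2 - Real.sqrt (((x' 0 - x' 1) / 2) ^ 2 + x' 2 ^ 2)) *
        ((1 / 2 - ((x' 0 + x' 1) / 2 + Real.sqrt (((x' 0 - x' 1) / 2) ^ 2 + x' 2 ^ 2))) *
          (1 / 2 - ((x' 0 + x' 1) / 2 - Real.sqrt (((x' 0 - x' 1) / 2) ^ 2 + x' 2 ^ 2)))) := by
    intro x'
    have hr2 :
        Real.sqrt (((x' 0 - x' 1) / 2) ^ 2 + x' 2 ^ 2) ^ 2 = ((x' 0 - x' 1) / 2) ^ 2 + x' 2 ^ 2 :=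
      Real.sq_sqrt (by positivity)
    set r := Real.sqrt (((x' 0 - x' 1) / 2) ^ 2 + x' 2 ^ 2)
    have e :
        ((x' 0 + x' 1) / 2 + r) * ((x' 0 + x' 1) / 2 - r) * ((1 / 2 - ((x' 0 + x' 1) / 2 + r)) *
        (1 / 2 - ((x' 0 + x' 1) / 2 - r))) =
        (((x' 0 + x' 1) / 2) ^ 2 - r ^ 2) * ((1 / 2 - (x' 0 + x' 1) / 2) ^ 2 - r ^ 2) := by ring
    rw [e, hr2]
    ring
  have e1 : ∫⁻ x' : Fin 3 → ℝ,
      (if 0 < (x' 0 + x' 1) / 2 - Real.sqrt (((x' 0 - x' 1) / 2) ^ 2 + x' 2 ^ 2) ∧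
        (x' 0 + x' 1) / 2 + Real.sqrt (((x' 0 - x' 1) / 2) ^ 2 + x' 2 ^ 2) < 1 / 2 then
      ENNReal.ofReal ((x' 0 * x' 1 - x' 2 ^ 2) * ((1 / 2 - x' 0) * (1 / 2 - x' 1) - x' 2 ^ 2)) *
        lovasAndaiChiOne 1 else 0) =
      ∫⁻ x' : Fin 3 → ℝ, Φ₁ ((x' 0 + x' 1) / 2 + Real.sqrt (((x' 0 - x' 1) / 2) ^ 2 + x' 2 ^ 2))
        ((x' 0 + x' 1) / 2 - Real.sqrt (((x' 0 - x' 1) / 2) ^ 2 + x' 2 ^ 2)) := by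
    refine lintegral_congr fun x' => ?_
    simp only [hΦ₁, hdet x']
  have e2 : ∫⁻ x' : Fin 3 → ℝ,
      (if 0 < (x' 0 + x' 1) / 2 - Real.sqrt (((x' 0 - x' 1) / 2) ^ 2 + x' 2 ^ 2) ∧
        (x' 0 + x' 1) / 2 + Real.sqrt (((x' 0 - x' 1) / 2) ^ 2 + x' 2 ^ 2) < 1 / 2 then
      ENNReal.ofReal ((x' 0 * x' 1 - x' 2 ^ 2) * ((1 / 2 - x' 0) * (1 / 2 - x' 1) - x' 2 ^ 2)) *
        lovasAndaiChiOne (Real.sqrt (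
          ((x' 0 + x' 1) / 2 - Real.sqrt (((x' 0 - x' 1) / 2) ^ 2 + x' 2 ^ 2)) *
            (1 / 2 - ((x' 0 + x' 1) / 2 + Real.sqrt (((x' 0 - x' 1) / 2) ^ 2 + x' 2 ^ 2))) /
          (((x' 0 + x' 1) / 2 + Real.sqrt (((x' 0 - x' 1) / 2) ^ 2 + x' 2 ^ 2)) *
            (1 / 2 - ((x' 0 + x' 1) / 2 - Real.sqrt (((x' 0 - x' 1) / 2) ^ 2 + x' 2 ^ 2))))))
        else 0) =
      ∫⁻ x' : Fin 3 → ℝ, Φ₂ ((x' 0 + x' 1) / 2 + Real.sqrt (((x' 0 - x' 1) / 2) ^ 2 + x' 2 ^ 2))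
        ((x' 0 + x' 1) / 2 - Real.sqrt (((x' 0 - x' 1) / 2) ^ 2 + x' 2 ^ 2)) := by
    refine lintegral_congr fun x' => ?_
    simp only [hΦ₂, hdet x']
  -- measurability of `Φ₁`, `Φ₂`
  have hpoly :
      Measurable fun p : ℝ × ℝ => ENNReal.ofReal (p.1 * p.2 * ((1 / 2 - p.1) * (1 / 2 - p.2))) := by
    fun_prop
  have hcond : MeasurableSet {p : ℝ × ℝ | 0 < p.2 ∧ p.1 < 1 / 2} :=
    (measurableSet_lt (measurable_const : Measurable fun _ : ℝ × ℝ => (0 : ℝ)) measurable_snd).inter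
      (measurableSet_lt measurable_fst (measurable_const : Measurable fun _ : ℝ × ℝ => (1 / 2 : ℝ)))
  have hΦ₁m : Measurable (Function.uncurry Φ₁) := by
    have : Function.uncurry Φ₁ = fun p : ℝ × ℝ => if 0 < p.2 ∧ p.1 < 1 / 2 then
        ENNReal.ofReal (p.1 * p.2 * ((1 / 2 - p.1) * (1 / 2 - p.2))) * lovasAndaiChiOne 1
        else 0 := by
      funext p; simp only [Function.uncurry, hΦ₁]
    rw [this]
    exact Measurable.ite hcond (hpoly.mul measurable_const) measurable_const
  have hΦ₂m : Measurable (Function.uncurry Φ₂) := by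
    have : Function.uncurry Φ₂ = fun p : ℝ × ℝ => if 0 < p.2 ∧ p.1 < 1 / 2 then
        ENNReal.ofReal (p.1 * p.2 * ((1 / 2 - p.1) * (1 / 2 - p.2))) *
          lovasAndaiChiOne (Real.sqrt (p.2 * (1 / 2 - p.1) / (p.1 * (1 / 2 - p.2)))) else 0 := by
      funext p; simp only [Function.uncurry, hΦ₂]
    rw [this]
    exact Measurable.ite hcond (hpoly.mul (measurable_lovasAndaiChiOne.comp (by fun_prop)))
      measurable_const
  rw [e1, e2, lintegral_eigenCoord Φ₂ hΦ₂m, lintegral_eigenCoord Φ₁ hΦ₁m]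
  -- identify with the integrals of the hypothesis
  have hind : ∀ (χ : ℝ × ℝ → ℝ≥0∞) (p : ℝ × ℝ),
      {p : ℝ × ℝ | p.2 < p.1}.indicator (fun p => ENNReal.ofReal (p.1 - p.2) *
        (if 0 < p.2 ∧ p.1 < 1 / 2 then
          ENNReal.ofReal (p.1 * p.2 * ((1 / 2 - p.1) * (1 / 2 - p.2))) * χ p else 0)) p =
      {p : ℝ × ℝ | 0 < p.2 ∧ p.2 < p.1 ∧ p.1 < 1 / 2}.indicator
        (fun p => ENNReal.ofReal ((p.1 - p.2) * (p.1 * p.2 * ((1 / 2 - p.1) * (1 / 2 - p.2)))) *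
          χ p) p := by
    intro χ p
    simp only [indicator, mem_setOf_eq]
    by_cases h1 : p.2 < p.1
    · by_cases h2 : 0 < p.2 ∧ p.1 < 1 / 2
      · rw [if_pos h1, if_pos h2, if_pos ⟨h2.1, h1, h2.2⟩, ← mul_assoc,
          ← ENNReal.ofReal_mul (by linarith)]
      · rw [if_pos h1, if_neg h2, if_neg (fun h => h2 ⟨h.1, h.2.2⟩), mul_zero]
    · rw [if_neg h1, if_neg (fun h => h1 h.2.1)]
  have hI1 : ∫⁻ p : ℝ × ℝ, {p : ℝ × ℝ | p.2 < p.1}.indicator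
      (fun p => ENNReal.ofReal (p.1 - p.2) * Φ₁ p.1 p.2) p =
      ∫⁻ p : ℝ × ℝ, {p : ℝ × ℝ | 0 < p.2 ∧ p.2 < p.1 ∧ p.1 < 1 / 2}.indicator
        (fun p => ENNReal.ofReal ((p.1 - p.2) * (p.1 * p.2 * ((1 / 2 - p.1) * (1 / 2 - p.2)))) *
          lovasAndaiChiOne 1) p :=
    lintegral_congr fun p => hind (fun _ => lovasAndaiChiOne 1) p
  have hI2 : ∫⁻ p : ℝ × ℝ, {p : ℝ × ℝ | p.2 < p.1}.indicator
      (fun p => ENNReal.ofReal (p.1 - p.2) * Φ₂ p.1 p.2) p =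
      ∫⁻ p : ℝ × ℝ, {p : ℝ × ℝ | 0 < p.2 ∧ p.2 < p.1 ∧ p.1 < 1 / 2}.indicator
        (fun p => ENNReal.ofReal ((p.1 - p.2) * (p.1 * p.2 * ((1 / 2 - p.1) * (1 / 2 - p.2)))) *
          lovasAndaiChiOne (Real.sqrt (p.2 * (1 / 2 - p.1) / (p.1 * (1 / 2 - p.2))))) p :=
    lintegral_congr fun p => hind (fun p => lovasAndaiChiOne
      (Real.sqrt (p.2 * (1 / 2 - p.1) / (p.1 * (1 / 2 - p.2))))) p
  rw [hI1, hI2, mul_left_comm, h, mul_left_comm]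
end Literature.Probability.RandomMatrix.LovasAndai

end
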